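import Summits.QuantumFields.QCD.Theorems.EulerDescentHonestHeavyAnchorRaySplit
import Summits.QuantumFields.QCD.Theorems.EulerDescentHonestHeavyAnchorUpperLocatorLatticeReduction

/-!
# Crux `EulerDescent.HonestHeavyAnchor` (stmt-QuantumFields-16901), line `bounded_locator` rev 3, stub
# `stub_nonMassiveBelowOfBody` (R, the NON-MASSIVE POINT BELOW): order bookkeeping and the θ = π reduction

Worker file (def-free, sorry-free) for the registered stub `stub_nonMassiveBelowOfBody` (R) of
`Cruxes/HonestHeavyAnchor/Lines/bounded_locator.lean` (rev 3, the RAY split): for `N_f ∈ {2,3}`, every mass-scaling,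
asymptotically scaling regularisation `reg` carrying the heavy body above `M` admits `C` such that, eventually in `k`,
SOME degenerate bare Wilson mass `μ ≥ m_crit(k) − a_k C/Z_m(k)` is NON-massive at `β_k`.  The stub is open-problem
grade and is NOT proved here.  What this file certifies:

* §1–§2 (ORDER): given the intrinsic corner (`∀ᶠ k, IsLUB NonMassive(β_k) (mc k)`), R's conclusion for `reg` and the
  conclusion of the OLD upper locator S4' (`stub_offsetBoundedAbove` of rev 1/2: the renormalised corner offset
  `(m_crit(k) − mc(k))·Z_m(k)/a_k` is eventually bounded above) are EQUIVALENT: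
  `offset_le_of_nonMassive_below` (R ⇒ S4' with `M₂ := C`: a non-massive `μ ≥ m_crit − aC/Z_m` forces `mc k ≥ μ`),
  `nonMassive_below_of_eventually_offset_lt` (S4' ⇒ R with `C := M₂ + 1`: `m_crit − aC/Z_m < mc k`, so by
  `IsLUB.exists_between` a point of the set lies above it), `nonMassiveBelow_iff_offsetBoundedAbove_of_corner` (the iff);
* §3 (RESHAPE GLUE): the new stub R implies the retired stub S4' VERBATIM
  (`stub_offsetBoundedAbove_of_nonMassiveBelowOfBody`); conversely S4' gives R's conclusion for every body-carrying
  regularisation WITH a closing corner (`nonMassiveBelow_of_corner_of_offsetBoundedAbove`), hence so does the landed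
  lattice-only decoupling hypothesis SLHCD of `HonestHeavyAnchorUpperLocator.offsetBoundedAbove_of_separatedLatticeDecoupling`
  (`nonMassiveBelow_of_corner_of_separatedLatticeDecoupling`: R ⟸ corner ∧ separated lattice decoupling);
* §4 (θ = π REDUCTION, card `Ideas/theta-pi-pinch.md`): LONG-RANGE ORDER of one gauge-invariant local observable at the
  MIRROR tuple `μ₁(k) := m_crit(k) − a_k M₀/Z_m(k)` (renormalised mass `−M₀`, degenerate; for `N_f = 3` this is lattice
  QCD at `θ_eff = N_f·π ≡ π` by the proved sign formula `Literature.Barriers.QuantumFields.WilsonDeterminantSign_holds`,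
  where Dashen/CP spontaneous breaking predicts two CP-conjugate vacua, hence long-range order of a CP-odd local
  observable on the periodic torus) makes `μ₁(k)` non-massive (`B := A`, `n := S`: `C e^{−δS} → 0 < q`), hence R with
  `C := M₀`: `nonMassive_below_of_mirrorLongRangeOrder` (one regularisation), `nonMassiveBelow_of_mirrorLongRangeOrder`
  (the registered statement of R verbatim from "every body-carrying reg has mirror LRO"), and the `N_f = 3` form
  `nonMassiveBelowOfBody_three_of_mirrorLongRangeOrder_three` together with the flavour split
  `nonMassiveBelowOfBody_of_two_of_three : R|_{N_f=2} → R|_{N_f=3} → R` (for `N_f = 2` the mirror side is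
  `θ_eff = 2π`: no LRO is expected, the supplier there is the PCAC sign flip or decoupling).

The physics (CP breaking at θ = π of `N_f = 3` Wilson lattice QCD at the negative heavy tuple; Witten 1980,
Gaiotto–Kapustin–Komargodski–Seiberg 2017/18 anomaly for `gcd(N_c, N_f) = 3`) is an INLINED HYPOTHESIS, not a theorem:
no lattice proof exists even at strong coupling.  Pure order/filter bookkeeping over `QCDOS.lean`; standard axioms; no
`def` (the non-massive set, the heavy body and SLHCD are written out verbatim so registered sub-goals match by name +
signature).
-/

namespace Summit.QuantumFields.QCD.Theorems.HonestHeavyAnchorNonMassiveBelow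

open scoped SchwartzMap
open Filter Topology
open Literature.MathematicalPhysics.QuantumFieldTheory
open Summit.QuantumFields.QCD.Theorems.HonestHeavyAnchorRaySplit (ray_below_le_corner_iff)

variable {Nf : ℕ}

/-! ## §1 The strict ray inequality (`a_k, Z_m(k) > 0`) -/

/-- `m_crit(k) − a_k C/Z_m(k) < c` iff `(m_crit(k) − c)·Z_m(k)/a_k < C` (`a_k, Z_m(k) > 0`). [folklore] -/
theorem ray_below_lt_corner_iff (reg : QCDRegularisation Nf) (c C : ℝ) (k : ℕ) :
    reg.mcrit k - reg.a k * C / reg.Zm k < c ↔ (reg.mcrit k - c) * reg.Zm k / reg.a k < C := by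
  have ha := reg.a_pos k
  have hZ := reg.Zm_pos k
  rw [div_lt_iff₀ ha, sub_lt_comm, lt_div_iff₀ hZ]
  constructor <;> intro h <;> nlinarith [h]

/-! ## §2 R ⟺ S4' given the corner (one regularisation) -/

/-- **(R ⇒ S4', order).**  If eventually `mc k` is the least upper bound of the non-massive degenerate bare masses at
`β_k` and eventually some NON-massive `μ ≥ m_crit(k) − a_k C/Z_m(k)` exists, then eventually
`(m_crit(k) − mc(k))·Z_m(k)/a_k ≤ C` (`μ ≤ mc k` as `μ` is in the set; then `ray_below_le_corner_iff`). [folklore] -/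
theorem offset_le_of_nonMassive_below :
    ∀ (Nf : ℕ) (reg : QCDRegularisation Nf) (mc : ℕ → ℝ) (C : ℝ),
      (∀ᶠ k in atTop, IsLUB {μ : ℝ | ¬ (∀ (R R' : ℕ) (A : QCDLatticeObservable Nf R)
        (B : QCDLatticeObservable Nf R'), ∃ (C δ : ℝ) (S₀ : ℕ), 0 < δ ∧ ∀ S : ℕ, S₀ ≤ S → ∀ n : ℕ, n ≤ S →
          ‖qcdLatticeConnectedCorr (reg.β k) (2 * S + 1) (fun _ : Fin Nf => μ) A B n‖ ≤ C * Real.exp (-(δ * n)))}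
        (mc k)) →
      (∀ᶠ k in atTop, ∃ μ : ℝ, reg.mcrit k - reg.a k * C / reg.Zm k ≤ μ ∧
        ¬ (∀ (R R' : ℕ) (A : QCDLatticeObservable Nf R) (B : QCDLatticeObservable Nf R'), ∃ (C δ : ℝ) (S₀ : ℕ),
          0 < δ ∧ ∀ S : ℕ, S₀ ≤ S → ∀ n : ℕ, n ≤ S →
            ‖qcdLatticeConnectedCorr (reg.β k) (2 * S + 1) (fun _ : Fin Nf => μ) A B n‖ ≤ C * Real.exp (-(δ * n)))) →
      ∀ᶠ k in atTop, (reg.mcrit k - mc k) * reg.Zm k / reg.a k ≤ C := by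
  intro Nf reg mc C hcorner hbelow
  filter_upwards [hcorner, hbelow] with k hc hk
  obtain ⟨μ, hμ, hN⟩ := hk
  exact (ray_below_le_corner_iff reg (mc k) C k).1 (hμ.trans (hc.1 hN))

/-- **(S4' ⇒ R, order).**  If eventually `mc k` is the least upper bound of the non-massive degenerate bare masses at
`β_k` and eventually `(m_crit(k) − mc(k))·Z_m(k)/a_k < C`, then eventually some non-massive `μ ≥ m_crit(k) − a_k C/Z_m(k)`
exists: `m_crit(k) − a_k C/Z_m(k) < mc k`, and a least upper bound has points of the set above anything below it
(`IsLUB.exists_between`). [folklore] -/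
theorem nonMassive_below_of_eventually_offset_lt :
    ∀ (Nf : ℕ) (reg : QCDRegularisation Nf) (mc : ℕ → ℝ) (C : ℝ),
      (∀ᶠ k in atTop, IsLUB {μ : ℝ | ¬ (∀ (R R' : ℕ) (A : QCDLatticeObservable Nf R)
        (B : QCDLatticeObservable Nf R'), ∃ (C δ : ℝ) (S₀ : ℕ), 0 < δ ∧ ∀ S : ℕ, S₀ ≤ S → ∀ n : ℕ, n ≤ S →
          ‖qcdLatticeConnectedCorr (reg.β k) (2 * S + 1) (fun _ : Fin Nf => μ) A B n‖ ≤ C * Real.exp (-(δ * n)))}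
        (mc k)) →
      (∀ᶠ k in atTop, (reg.mcrit k - mc k) * reg.Zm k / reg.a k < C) →
      ∀ᶠ k in atTop, ∃ μ : ℝ, reg.mcrit k - reg.a k * C / reg.Zm k ≤ μ ∧
        ¬ (∀ (R R' : ℕ) (A : QCDLatticeObservable Nf R) (B : QCDLatticeObservable Nf R'), ∃ (C δ : ℝ) (S₀ : ℕ),
          0 < δ ∧ ∀ S : ℕ, S₀ ≤ S → ∀ n : ℕ, n ≤ S →
            ‖qcdLatticeConnectedCorr (reg.β k) (2 * S + 1) (fun _ : Fin Nf => μ) A B n‖ ≤ C * Real.exp (-(δ * n))) := by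
  intro Nf reg mc C hcorner hoff
  filter_upwards [hcorner, hoff] with k hc hk
  have hlt : reg.mcrit k - reg.a k * C / reg.Zm k < mc k := (ray_below_lt_corner_iff reg (mc k) C k).2 hk
  obtain ⟨μ, hμN, hμgt, -⟩ := hc.exists_between hlt
  exact ⟨μ, hμgt.le, hμN⟩

/-- **R ⟺ S4' given the corner.**  For a regularisation whose couplings eventually have the intrinsic corner `mc`:
"for some `C`, eventually some non-massive degenerate bare mass `≥ m_crit(k) − a_k C/Z_m(k)` exists" iff "the offset
`(m_crit − mc)·Z_m/a` is eventually bounded above" (`offset_le_of_nonMassive_below` with `M₂ := C`;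
`nonMassive_below_of_eventually_offset_lt` with `C := M₂ + 1`).  So the rev-3 stub R is exactly the corner-free content
of the retired rev-1/2 upper locator `stub_offsetBoundedAbove`. [folklore] -/
theorem nonMassiveBelow_iff_offsetBoundedAbove_of_corner :
    ∀ (Nf : ℕ) (reg : QCDRegularisation Nf) (mc : ℕ → ℝ),
      (∀ᶠ k in atTop, IsLUB {μ : ℝ | ¬ (∀ (R R' : ℕ) (A : QCDLatticeObservable Nf R)
        (B : QCDLatticeObservable Nf R'), ∃ (C δ : ℝ) (S₀ : ℕ), 0 < δ ∧ ∀ S : ℕ, S₀ ≤ S → ∀ n : ℕ, n ≤ S →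
          ‖qcdLatticeConnectedCorr (reg.β k) (2 * S + 1) (fun _ : Fin Nf => μ) A B n‖ ≤ C * Real.exp (-(δ * n)))}
        (mc k)) →
      ((∃ C : ℝ, ∀ᶠ k in atTop, ∃ μ : ℝ, reg.mcrit k - reg.a k * C / reg.Zm k ≤ μ ∧
        ¬ (∀ (R R' : ℕ) (A : QCDLatticeObservable Nf R) (B : QCDLatticeObservable Nf R'), ∃ (C δ : ℝ) (S₀ : ℕ),
          0 < δ ∧ ∀ S : ℕ, S₀ ≤ S → ∀ n : ℕ, n ≤ S →
            ‖qcdLatticeConnectedCorr (reg.β k) (2 * S + 1) (fun _ : Fin Nf => μ) A B n‖ ≤ C * Real.exp (-(δ * n)))) ↔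
        ∃ M₂ : ℝ, ∀ᶠ k in atTop, (reg.mcrit k - mc k) * reg.Zm k / reg.a k ≤ M₂) := by
  intro Nf reg mc hcorner
  constructor
  · rintro ⟨C, h⟩
    exact ⟨C, offset_le_of_nonMassive_below Nf reg mc C hcorner h⟩
  · rintro ⟨M₂, h⟩
    exact ⟨M₂ + 1, nonMassive_below_of_eventually_offset_lt Nf reg mc (M₂ + 1) hcorner
      (h.mono fun k hk => by linarith)⟩

/-! ## §3 Reshape glue: R (rev 3) versus the retired upper locator S4' (rev 1/2) and the landed decoupling reduction -/

/-- **R ⇒ S4' verbatim.**  The registered statement of `stub_nonMassiveBelowOfBody` (rev 3) implies the registered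
statement of the retired `stub_offsetBoundedAbove` (rev 1/2): apply R to the body-carrying regularisation and use
`offset_le_of_nonMassive_below` with its corner (the hypothesis `mc → 0` of S4' is not needed). [folklore] -/
theorem stub_offsetBoundedAbove_of_nonMassiveBelowOfBody :
    (∀ Nf : ℕ, Nf = 2 ∨ Nf = 3 → ∀ (reg : QCDRegularisation Nf) (M : ℝ), reg.HasMassScaling →
      (reg.scheme 0 0 0).HasAsymptoticScaling →
      (∀ m : Fin Nf → ℝ, (∀ f, M < m f) → ∃ (z shift : QCDField Nf → ℕ → ℝ) (T : OSData (QCDField Nf) 4),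
        IsQCDAlong (reg.scheme m z shift) T ∧ T.IsNontrivial QCDField.glue ∧ T.IsNonGaussian QCDField.glue ∧
          (∀ f g : Fin Nf, f ≠ g → T.IsNontrivial (QCDField.pseudoRe f g)) ∧
            ∃ Δ > 0, T.HasMassGap Δ ∧ (reg.scheme m z shift).HasLatticeMassGap Δ) →
      ∃ C : ℝ, ∀ᶠ k in atTop, ∃ μ : ℝ, reg.mcrit k - reg.a k * C / reg.Zm k ≤ μ ∧
        ¬ (∀ (R R' : ℕ) (A : QCDLatticeObservable Nf R) (B : QCDLatticeObservable Nf R'), ∃ (C δ : ℝ) (S₀ : ℕ),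
          0 < δ ∧ ∀ S : ℕ, S₀ ≤ S → ∀ n : ℕ, n ≤ S →
            ‖qcdLatticeConnectedCorr (reg.β k) (2 * S + 1) (fun _ : Fin Nf => μ) A B n‖ ≤ C * Real.exp (-(δ * n)))) →
    ∀ Nf : ℕ, Nf = 2 ∨ Nf = 3 → ∀ (reg : QCDRegularisation Nf) (mc : ℕ → ℝ) (M : ℝ), reg.HasMassScaling →
      (reg.scheme 0 0 0).HasAsymptoticScaling →
      (∀ᶠ k in atTop, IsLUB {μ : ℝ | ¬ (∀ (R R' : ℕ) (A : QCDLatticeObservable Nf R)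
        (B : QCDLatticeObservable Nf R'), ∃ (C δ : ℝ) (S₀ : ℕ), 0 < δ ∧ ∀ S : ℕ, S₀ ≤ S → ∀ n : ℕ, n ≤ S →
          ‖qcdLatticeConnectedCorr (reg.β k) (2 * S + 1) (fun _ : Fin Nf => μ) A B n‖ ≤ C * Real.exp (-(δ * n)))} (mc k)) →
      Tendsto mc atTop (𝓝 0) →
      (∀ m : Fin Nf → ℝ, (∀ f, M < m f) → ∃ (z shift : QCDField Nf → ℕ → ℝ) (T : OSData (QCDField Nf) 4),
        IsQCDAlong (reg.scheme m z shift) T ∧ T.IsNontrivial QCDField.glue ∧ T.IsNonGaussian QCDField.glue ∧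
          (∀ f g : Fin Nf, f ≠ g → T.IsNontrivial (QCDField.pseudoRe f g)) ∧
            ∃ Δ > 0, T.HasMassGap Δ ∧ (reg.scheme m z shift).HasLatticeMassGap Δ) →
      ∃ M₂ : ℝ, ∀ᶠ k in atTop, (reg.mcrit k - mc k) * reg.Zm k / reg.a k ≤ M₂ := by
  intro hR Nf hNf reg mc M hms haf hcorner _hmc hbody
  obtain ⟨C, hbelow⟩ := hR Nf hNf reg M hms haf hbody
  exact ⟨C, offset_le_of_nonMassive_below Nf reg mc C hcorner hbelow⟩

/-- **S4' ⇒ R for regularisations with a closing corner.**  The registered statement of the retired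
`stub_offsetBoundedAbove` (rev 1/2) gives R's conclusion for every `N_f ∈ {2,3}`, mass-scaling, asymptotically scaling,
body-carrying regularisation whose couplings eventually have an intrinsic corner `mc → 0`
(`nonMassive_below_of_eventually_offset_lt` with `C := M₂ + 1`). [folklore] -/
theorem nonMassiveBelow_of_corner_of_offsetBoundedAbove :
    (∀ Nf : ℕ, Nf = 2 ∨ Nf = 3 → ∀ (reg : QCDRegularisation Nf) (mc : ℕ → ℝ) (M : ℝ), reg.HasMassScaling →
      (reg.scheme 0 0 0).HasAsymptoticScaling →
      (∀ᶠ k in atTop, IsLUB {μ : ℝ | ¬ (∀ (R R' : ℕ) (A : QCDLatticeObservable Nf R)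
        (B : QCDLatticeObservable Nf R'), ∃ (C δ : ℝ) (S₀ : ℕ), 0 < δ ∧ ∀ S : ℕ, S₀ ≤ S → ∀ n : ℕ, n ≤ S →
          ‖qcdLatticeConnectedCorr (reg.β k) (2 * S + 1) (fun _ : Fin Nf => μ) A B n‖ ≤ C * Real.exp (-(δ * n)))} (mc k)) →
      Tendsto mc atTop (𝓝 0) →
      (∀ m : Fin Nf → ℝ, (∀ f, M < m f) → ∃ (z shift : QCDField Nf → ℕ → ℝ) (T : OSData (QCDField Nf) 4),
        IsQCDAlong (reg.scheme m z shift) T ∧ T.IsNontrivial QCDField.glue ∧ T.IsNonGaussian QCDField.glue ∧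
          (∀ f g : Fin Nf, f ≠ g → T.IsNontrivial (QCDField.pseudoRe f g)) ∧
            ∃ Δ > 0, T.HasMassGap Δ ∧ (reg.scheme m z shift).HasLatticeMassGap Δ) →
      ∃ M₂ : ℝ, ∀ᶠ k in atTop, (reg.mcrit k - mc k) * reg.Zm k / reg.a k ≤ M₂) →
    ∀ Nf : ℕ, Nf = 2 ∨ Nf = 3 → ∀ (reg : QCDRegularisation Nf) (mc : ℕ → ℝ) (M : ℝ), reg.HasMassScaling →
      (reg.scheme 0 0 0).HasAsymptoticScaling →
      (∀ᶠ k in atTop, IsLUB {μ : ℝ | ¬ (∀ (R R' : ℕ) (A : QCDLatticeObservable Nf R)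
        (B : QCDLatticeObservable Nf R'), ∃ (C δ : ℝ) (S₀ : ℕ), 0 < δ ∧ ∀ S : ℕ, S₀ ≤ S → ∀ n : ℕ, n ≤ S →
          ‖qcdLatticeConnectedCorr (reg.β k) (2 * S + 1) (fun _ : Fin Nf => μ) A B n‖ ≤ C * Real.exp (-(δ * n)))} (mc k)) →
      Tendsto mc atTop (𝓝 0) →
      (∀ m : Fin Nf → ℝ, (∀ f, M < m f) → ∃ (z shift : QCDField Nf → ℕ → ℝ) (T : OSData (QCDField Nf) 4),
        IsQCDAlong (reg.scheme m z shift) T ∧ T.IsNontrivial QCDField.glue ∧ T.IsNonGaussian QCDField.glue ∧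
          (∀ f g : Fin Nf, f ≠ g → T.IsNontrivial (QCDField.pseudoRe f g)) ∧
            ∃ Δ > 0, T.HasMassGap Δ ∧ (reg.scheme m z shift).HasLatticeMassGap Δ) →
      ∃ C : ℝ, ∀ᶠ k in atTop, ∃ μ : ℝ, reg.mcrit k - reg.a k * C / reg.Zm k ≤ μ ∧
        ¬ (∀ (R R' : ℕ) (A : QCDLatticeObservable Nf R) (B : QCDLatticeObservable Nf R'), ∃ (C δ : ℝ) (S₀ : ℕ),
          0 < δ ∧ ∀ S : ℕ, S₀ ≤ S → ∀ n : ℕ, n ≤ S →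
            ‖qcdLatticeConnectedCorr (reg.β k) (2 * S + 1) (fun _ : Fin Nf => μ) A B n‖ ≤ C * Real.exp (-(δ * n))) := by
  intro hS Nf hNf reg mc M hms haf hcorner hmc hbody
  obtain ⟨M₂, h⟩ := hS Nf hNf reg mc M hms haf hcorner hmc hbody
  exact ⟨M₂ + 1, nonMassive_below_of_eventually_offset_lt Nf reg mc (M₂ + 1) hcorner (h.mono fun k hk => by linarith)⟩

/-- **R ⟸ corner ∧ separated lattice heavy-channel decoupling.**  The lattice-only hypothesis SLHCD of the landed
`HonestHeavyAnchorUpperLocator.offsetBoundedAbove_of_separatedLatticeDecoupling` (verbatim: along a mass-scaling,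
asymptotically scaling `reg` with a closing corner and corner offset `→ +∞`, on the branch with a uniform lattice gap,
convergence of the smeared `Re ψ̄_f iγ₅ ψ_g` two-point functions on all separated real pairs and of its one-point
functions forces the truncated two-point function to vanish on every strictly separated real pair) gives R's conclusion
for every `N_f ∈ {2,3}` body-carrying regularisation with a closing intrinsic corner: compose that theorem with
`nonMassiveBelow_of_corner_of_offsetBoundedAbove`. [folklore] -/
theorem nonMassiveBelow_of_corner_of_separatedLatticeDecoupling :
    (∀ Nf : ℕ, Nf = 2 ∨ Nf = 3 → ∀ (reg : QCDRegularisation Nf) (mc : ℕ → ℝ), reg.HasMassScaling →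
      (reg.scheme 0 0 0).HasAsymptoticScaling →
      (∀ᶠ k in atTop, IsLUB {μ : ℝ | ¬ (∀ (R R' : ℕ) (A : QCDLatticeObservable Nf R)
        (B : QCDLatticeObservable Nf R'), ∃ (C δ : ℝ) (S₀ : ℕ), 0 < δ ∧ ∀ S : ℕ, S₀ ≤ S → ∀ n : ℕ, n ≤ S →
          ‖qcdLatticeConnectedCorr (reg.β k) (2 * S + 1) (fun _ : Fin Nf => μ) A B n‖ ≤ C * Real.exp (-(δ * n)))} (mc k)) →
      Tendsto mc atTop (𝓝 0) →
      Tendsto (fun k => (reg.mcrit k - mc k) * reg.Zm k / reg.a k) atTop atTop →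
      ∀ (m : Fin Nf → ℝ) (z shift : QCDField Nf → ℕ → ℝ),
      (∀ fl : Fin Nf, ∀ᶠ k in atTop, -1 < (reg.scheme m z shift).mq fl k) →
      (∃ Δ > 0, (reg.scheme m z shift).HasLatticeMassGap Δ) →
      ∀ f g : Fin Nf, f ≠ g →
      (∀ u v : 𝓢(EuclideanSpace ℝ (Fin 4), ℝ), tsupport u ⊆ {y : EuclideanSpace ℝ (Fin 4) | y 0 < 0} →
        tsupport v ⊆ {y : EuclideanSpace ℝ (Fin 4) | 0 < y 0} →
        ∃ c₂ : ℂ, Tendsto (fun k : ℕ => qcdLatticeSchwinger (reg.scheme m z shift) k (1 + 1)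
          (fun _ => QCDField.pseudoRe f g) ![u, v]) atTop (𝓝 c₂)) →
      (∀ w : 𝓢(EuclideanSpace ℝ (Fin 4), ℝ), ∃ c₁ : ℂ, Tendsto (fun k : ℕ => qcdLatticeSchwinger (reg.scheme m z shift) k 1
          (fun _ => QCDField.pseudoRe f g) ![w]) atTop (𝓝 c₁)) →
      ∀ ε : ℝ, 0 < ε → ∀ u v : 𝓢(EuclideanSpace ℝ (Fin 4), ℝ),
      tsupport u ⊆ {y : EuclideanSpace ℝ (Fin 4) | y 0 < -ε} → tsupport v ⊆ {y : EuclideanSpace ℝ (Fin 4) | ε < y 0} →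
      Tendsto (fun k : ℕ => qcdLatticeSchwinger (reg.scheme m z shift) k (1 + 1) (fun _ => QCDField.pseudoRe f g) ![u, v] -
        qcdLatticeSchwinger (reg.scheme m z shift) k 1 (fun _ => QCDField.pseudoRe f g) ![u] *
          qcdLatticeSchwinger (reg.scheme m z shift) k 1 (fun _ => QCDField.pseudoRe f g) ![v]) atTop (𝓝 0)) →
    ∀ Nf : ℕ, Nf = 2 ∨ Nf = 3 → ∀ (reg : QCDRegularisation Nf) (mc : ℕ → ℝ) (M : ℝ), reg.HasMassScaling →
      (reg.scheme 0 0 0).HasAsymptoticScaling →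
      (∀ᶠ k in atTop, IsLUB {μ : ℝ | ¬ (∀ (R R' : ℕ) (A : QCDLatticeObservable Nf R)
        (B : QCDLatticeObservable Nf R'), ∃ (C δ : ℝ) (S₀ : ℕ), 0 < δ ∧ ∀ S : ℕ, S₀ ≤ S → ∀ n : ℕ, n ≤ S →
          ‖qcdLatticeConnectedCorr (reg.β k) (2 * S + 1) (fun _ : Fin Nf => μ) A B n‖ ≤ C * Real.exp (-(δ * n)))} (mc k)) →
      Tendsto mc atTop (𝓝 0) →
      (∀ m : Fin Nf → ℝ, (∀ f, M < m f) → ∃ (z shift : QCDField Nf → ℕ → ℝ) (T : OSData (QCDField Nf) 4),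
        IsQCDAlong (reg.scheme m z shift) T ∧ T.IsNontrivial QCDField.glue ∧ T.IsNonGaussian QCDField.glue ∧
          (∀ f g : Fin Nf, f ≠ g → T.IsNontrivial (QCDField.pseudoRe f g)) ∧
            ∃ Δ > 0, T.HasMassGap Δ ∧ (reg.scheme m z shift).HasLatticeMassGap Δ) →
      ∃ C : ℝ, ∀ᶠ k in atTop, ∃ μ : ℝ, reg.mcrit k - reg.a k * C / reg.Zm k ≤ μ ∧
        ¬ (∀ (R R' : ℕ) (A : QCDLatticeObservable Nf R) (B : QCDLatticeObservable Nf R'), ∃ (C δ : ℝ) (S₀ : ℕ),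
          0 < δ ∧ ∀ S : ℕ, S₀ ≤ S → ∀ n : ℕ, n ≤ S →
            ‖qcdLatticeConnectedCorr (reg.β k) (2 * S + 1) (fun _ : Fin Nf => μ) A B n‖ ≤ C * Real.exp (-(δ * n))) := by
  intro hlat
  exact nonMassiveBelow_of_corner_of_offsetBoundedAbove
    (HonestHeavyAnchorUpperLocator.offsetBoundedAbove_of_separatedLatticeDecoupling hlat)

/-! ## §4 The θ = π reduction: long-range order at the mirror tuple is a non-massiveness certificate -/

/-- **Mirror long-range order ⇒ a non-massive point at RGI depth `M₀` (one regularisation).**  If eventually in `k`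
some gauge-invariant local observable `A` has LONG-RANGE ORDER at coupling `β_k` and the degenerate mirror bare mass
`μ₁(k) := m_crit(k) − a_k M₀/Z_m(k)` — `‖⟨A(0)·A(S e₀)⟩^conn_{2S+1}‖ ≥ q > 0` on every large odd torus, at the maximal
separation `S` — then eventually `μ₁(k)` itself is a non-massive degenerate bare mass `≥ m_crit(k) − a_k M₀/Z_m(k)`:
exponential clustering of the pair `(A, A)` would give `q ≤ C e^{−δS} → 0`.  For `N_f = 3` the mirror tuple is lattice
QCD at `θ_eff = π` (sign formula `Literature.Barriers.QuantumFields.WilsonDeterminantSign_holds`), where Dashen/CP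
breaking predicts exactly such order for a CP-odd `A`; that physics is the HYPOTHESIS here. [folklore] -/
theorem nonMassive_below_of_mirrorLongRangeOrder :
    ∀ (Nf : ℕ) (reg : QCDRegularisation Nf) (M₀ : ℝ),
      (∀ᶠ k in atTop, ∃ (R₀ : ℕ) (A : QCDLatticeObservable Nf R₀) (q : ℝ) (S₁ : ℕ), 0 < q ∧ ∀ S : ℕ, S₁ ≤ S →
        q ≤ ‖qcdLatticeConnectedCorr (reg.β k) (2 * S + 1) (fun _ : Fin Nf => reg.mcrit k - reg.a k * M₀ / reg.Zm k)
          A A S‖) →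
      ∀ᶠ k in atTop, ∃ μ : ℝ, reg.mcrit k - reg.a k * M₀ / reg.Zm k ≤ μ ∧
        ¬ (∀ (R R' : ℕ) (A : QCDLatticeObservable Nf R) (B : QCDLatticeObservable Nf R'), ∃ (C δ : ℝ) (S₀ : ℕ),
          0 < δ ∧ ∀ S : ℕ, S₀ ≤ S → ∀ n : ℕ, n ≤ S →
            ‖qcdLatticeConnectedCorr (reg.β k) (2 * S + 1) (fun _ : Fin Nf => μ) A B n‖ ≤ C * Real.exp (-(δ * n))) := by
  intro Nf reg M₀ hlro
  refine hlro.mono fun k hk => ?_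
  obtain ⟨R₀, A, q, S₁, hq, hord⟩ := hk
  refine ⟨reg.mcrit k - reg.a k * M₀ / reg.Zm k, le_rfl, fun hmass => ?_⟩
  obtain ⟨C, δ, S₀, hδ, hdec⟩ := hmass R₀ R₀ A A
  -- the clustering bound at the maximal separation tends to `0`, the order parameter does not
  have hexp : Tendsto (fun S : ℕ => Real.exp (-(δ * (S : ℝ)))) atTop (𝓝 0) :=
    Real.tendsto_exp_atBot.comp
      (tendsto_neg_atTop_atBot.comp (tendsto_natCast_atTop_atTop.const_mul_atTop hδ))
  have hCexp : Tendsto (fun S : ℕ => C * Real.exp (-(δ * (S : ℝ)))) atTop (𝓝 0) := by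
    simpa using hexp.const_mul C
  obtain ⟨S, hS₀, hS₁, hS⟩ :=
    ((eventually_ge_atTop S₀).and ((eventually_ge_atTop S₁).and (hCexp.eventually_lt_const hq))).exists
  have h₁ := hord S hS₁
  have h₂ := hdec S hS₀ S le_rfl
  linarith

/-- **MIRROR LONG-RANGE ORDER ⇒ R (the registered statement of `stub_nonMassiveBelowOfBody`, verbatim).**
Hypothesis (OPEN physics, inlined; the θ = π supplier of card `Ideas/theta-pi-pinch.md`): for `N_f ∈ {2,3}`, every
mass-scaling, asymptotically scaling regularisation carrying the heavy body above `M` has, for some `M₀`, eventually in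
`k` long-range order of ONE gauge-invariant local observable at coupling `β_k` and the degenerate MIRROR bare mass
`m_crit(k) − a_k M₀/Z_m(k)` (renormalised mass `−M₀`): `‖⟨A(0)·A(S e₀)⟩^conn_{2S+1}‖ ≥ q > 0` for all large `S`.
Conclusion: R with `C := M₀`, by `nonMassive_below_of_mirrorLongRangeOrder`.  Physically credible only for `N_f = 3`
(`θ_eff = 3π ≡ π`, Dashen/CP breaking, `gcd(N_c, N_f) = 3` anomaly); for `N_f = 2` (`θ_eff = 2π`) no order is
expected — see `nonMassiveBelowOfBody_three_of_mirrorLongRangeOrder_three` and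
`nonMassiveBelowOfBody_of_two_of_three`. [folklore] -/
theorem nonMassiveBelow_of_mirrorLongRangeOrder :
    (∀ Nf : ℕ, Nf = 2 ∨ Nf = 3 → ∀ (reg : QCDRegularisation Nf) (M : ℝ), reg.HasMassScaling →
      (reg.scheme 0 0 0).HasAsymptoticScaling →
      (∀ m : Fin Nf → ℝ, (∀ f, M < m f) → ∃ (z shift : QCDField Nf → ℕ → ℝ) (T : OSData (QCDField Nf) 4),
        IsQCDAlong (reg.scheme m z shift) T ∧ T.IsNontrivial QCDField.glue ∧ T.IsNonGaussian QCDField.glue ∧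
          (∀ f g : Fin Nf, f ≠ g → T.IsNontrivial (QCDField.pseudoRe f g)) ∧
            ∃ Δ > 0, T.HasMassGap Δ ∧ (reg.scheme m z shift).HasLatticeMassGap Δ) →
      ∃ M₀ : ℝ, ∀ᶠ k in atTop, ∃ (R₀ : ℕ) (A : QCDLatticeObservable Nf R₀) (q : ℝ) (S₁ : ℕ), 0 < q ∧
        ∀ S : ℕ, S₁ ≤ S → q ≤ ‖qcdLatticeConnectedCorr (reg.β k) (2 * S + 1)
          (fun _ : Fin Nf => reg.mcrit k - reg.a k * M₀ / reg.Zm k) A A S‖) →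
    ∀ Nf : ℕ, Nf = 2 ∨ Nf = 3 → ∀ (reg : QCDRegularisation Nf) (M : ℝ), reg.HasMassScaling →
    (reg.scheme 0 0 0).HasAsymptoticScaling →
    (∀ m : Fin Nf → ℝ, (∀ f, M < m f) → ∃ (z shift : QCDField Nf → ℕ → ℝ) (T : OSData (QCDField Nf) 4),
    IsQCDAlong (reg.scheme m z shift) T ∧ T.IsNontrivial QCDField.glue ∧ T.IsNonGaussian QCDField.glue ∧
    (∀ f g : Fin Nf, f ≠ g → T.IsNontrivial (QCDField.pseudoRe f g)) ∧
    ∃ Δ > 0, T.HasMassGap Δ ∧ (reg.scheme m z shift).HasLatticeMassGap Δ) →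
    ∃ C : ℝ, ∀ᶠ k in atTop, ∃ μ : ℝ, reg.mcrit k - reg.a k * C / reg.Zm k ≤ μ ∧
    ¬ (∀ (R R' : ℕ) (A : QCDLatticeObservable Nf R) (B : QCDLatticeObservable Nf R'), ∃ (C δ : ℝ) (S₀ : ℕ),
    0 < δ ∧ ∀ S : ℕ, S₀ ≤ S → ∀ n : ℕ, n ≤ S →
    ‖qcdLatticeConnectedCorr (reg.β k) (2 * S + 1) (fun _ : Fin Nf => μ) A B n‖ ≤ C * Real.exp (-(δ * n))) := by
  intro hLRO Nf hNf reg M hms haf hbody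
  obtain ⟨M₀, hlro⟩ := hLRO Nf hNf reg M hms haf hbody
  exact ⟨M₀, nonMassive_below_of_mirrorLongRangeOrder Nf reg M₀ hlro⟩

/-- **The `N_f = 3` form: mirror long-range order of three-flavour body-carrying regularisations ⇒ R at `N_f = 3`.**
Hypothesis (OPEN; the physically expected case — three degenerate Wilson flavours at the negative heavy mirror tuple
are lattice QCD at `θ = π`, `WilsonDeterminantSign.pow_odd_neg_iff`): every mass-scaling, asymptotically scaling
`reg : QCDRegularisation 3` carrying the heavy body above `M` has eventual long-range order of one local observable at
its mirror tuple `m_crit(k) − a_k M₀/Z_m(k)` for some `M₀`.  Conclusion: R's statement at `N_f = 3`. [folklore] -/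
theorem nonMassiveBelowOfBody_three_of_mirrorLongRangeOrder_three :
    (∀ (reg : QCDRegularisation 3) (M : ℝ), reg.HasMassScaling → (reg.scheme 0 0 0).HasAsymptoticScaling →
      (∀ m : Fin 3 → ℝ, (∀ f, M < m f) → ∃ (z shift : QCDField 3 → ℕ → ℝ) (T : OSData (QCDField 3) 4),
        IsQCDAlong (reg.scheme m z shift) T ∧ T.IsNontrivial QCDField.glue ∧ T.IsNonGaussian QCDField.glue ∧
          (∀ f g : Fin 3, f ≠ g → T.IsNontrivial (QCDField.pseudoRe f g)) ∧
            ∃ Δ > 0, T.HasMassGap Δ ∧ (reg.scheme m z shift).HasLatticeMassGap Δ) →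
      ∃ M₀ : ℝ, ∀ᶠ k in atTop, ∃ (R₀ : ℕ) (A : QCDLatticeObservable 3 R₀) (q : ℝ) (S₁ : ℕ), 0 < q ∧
        ∀ S : ℕ, S₁ ≤ S → q ≤ ‖qcdLatticeConnectedCorr (reg.β k) (2 * S + 1)
          (fun _ : Fin 3 => reg.mcrit k - reg.a k * M₀ / reg.Zm k) A A S‖) →
    ∀ (reg : QCDRegularisation 3) (M : ℝ), reg.HasMassScaling → (reg.scheme 0 0 0).HasAsymptoticScaling →
      (∀ m : Fin 3 → ℝ, (∀ f, M < m f) → ∃ (z shift : QCDField 3 → ℕ → ℝ) (T : OSData (QCDField 3) 4),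
        IsQCDAlong (reg.scheme m z shift) T ∧ T.IsNontrivial QCDField.glue ∧ T.IsNonGaussian QCDField.glue ∧
          (∀ f g : Fin 3, f ≠ g → T.IsNontrivial (QCDField.pseudoRe f g)) ∧
            ∃ Δ > 0, T.HasMassGap Δ ∧ (reg.scheme m z shift).HasLatticeMassGap Δ) →
      ∃ C : ℝ, ∀ᶠ k in atTop, ∃ μ : ℝ, reg.mcrit k - reg.a k * C / reg.Zm k ≤ μ ∧
        ¬ (∀ (R R' : ℕ) (A : QCDLatticeObservable 3 R) (B : QCDLatticeObservable 3 R'), ∃ (C δ : ℝ) (S₀ : ℕ),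
          0 < δ ∧ ∀ S : ℕ, S₀ ≤ S → ∀ n : ℕ, n ≤ S →
            ‖qcdLatticeConnectedCorr (reg.β k) (2 * S + 1) (fun _ : Fin 3 => μ) A B n‖ ≤ C * Real.exp (-(δ * n))) := by
  intro hLRO reg M hms haf hbody
  obtain ⟨M₀, hlro⟩ := hLRO reg M hms haf hbody
  exact ⟨M₀, nonMassive_below_of_mirrorLongRangeOrder 3 reg M₀ hlro⟩

/-- **Flavour split of R.**  The registered statement of `stub_nonMassiveBelowOfBody` from its `N_f = 2` and `N_f = 3`
instances (case split on `Nf = 2 ∨ Nf = 3`) — so the stub may be reshaped into an `N_f = 3` half (supplier: mirror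
long-range order at θ = π, `nonMassiveBelowOfBody_three_of_mirrorLongRangeOrder_three`) and an `N_f = 2` half
(supplier: PCAC sign flip or heavy-channel decoupling). [folklore] -/
theorem nonMassiveBelowOfBody_of_two_of_three :
    (∀ (reg : QCDRegularisation 2) (M : ℝ), reg.HasMassScaling → (reg.scheme 0 0 0).HasAsymptoticScaling →
      (∀ m : Fin 2 → ℝ, (∀ f, M < m f) → ∃ (z shift : QCDField 2 → ℕ → ℝ) (T : OSData (QCDField 2) 4),
        IsQCDAlong (reg.scheme m z shift) T ∧ T.IsNontrivial QCDField.glue ∧ T.IsNonGaussian QCDField.glue ∧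
          (∀ f g : Fin 2, f ≠ g → T.IsNontrivial (QCDField.pseudoRe f g)) ∧
            ∃ Δ > 0, T.HasMassGap Δ ∧ (reg.scheme m z shift).HasLatticeMassGap Δ) →
      ∃ C : ℝ, ∀ᶠ k in atTop, ∃ μ : ℝ, reg.mcrit k - reg.a k * C / reg.Zm k ≤ μ ∧
        ¬ (∀ (R R' : ℕ) (A : QCDLatticeObservable 2 R) (B : QCDLatticeObservable 2 R'), ∃ (C δ : ℝ) (S₀ : ℕ),
          0 < δ ∧ ∀ S : ℕ, S₀ ≤ S → ∀ n : ℕ, n ≤ S →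
            ‖qcdLatticeConnectedCorr (reg.β k) (2 * S + 1) (fun _ : Fin 2 => μ) A B n‖ ≤ C * Real.exp (-(δ * n)))) →
    (∀ (reg : QCDRegularisation 3) (M : ℝ), reg.HasMassScaling → (reg.scheme 0 0 0).HasAsymptoticScaling →
      (∀ m : Fin 3 → ℝ, (∀ f, M < m f) → ∃ (z shift : QCDField 3 → ℕ → ℝ) (T : OSData (QCDField 3) 4),
        IsQCDAlong (reg.scheme m z shift) T ∧ T.IsNontrivial QCDField.glue ∧ T.IsNonGaussian QCDField.glue ∧
          (∀ f g : Fin 3, f ≠ g → T.IsNontrivial (QCDField.pseudoRe f g)) ∧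
            ∃ Δ > 0, T.HasMassGap Δ ∧ (reg.scheme m z shift).HasLatticeMassGap Δ) →
      ∃ C : ℝ, ∀ᶠ k in atTop, ∃ μ : ℝ, reg.mcrit k - reg.a k * C / reg.Zm k ≤ μ ∧
        ¬ (∀ (R R' : ℕ) (A : QCDLatticeObservable 3 R) (B : QCDLatticeObservable 3 R'), ∃ (C δ : ℝ) (S₀ : ℕ),
          0 < δ ∧ ∀ S : ℕ, S₀ ≤ S → ∀ n : ℕ, n ≤ S →
            ‖qcdLatticeConnectedCorr (reg.β k) (2 * S + 1) (fun _ : Fin 3 => μ) A B n‖ ≤ C * Real.exp (-(δ * n)))) →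
    ∀ Nf : ℕ, Nf = 2 ∨ Nf = 3 → ∀ (reg : QCDRegularisation Nf) (M : ℝ), reg.HasMassScaling →
    (reg.scheme 0 0 0).HasAsymptoticScaling →
    (∀ m : Fin Nf → ℝ, (∀ f, M < m f) → ∃ (z shift : QCDField Nf → ℕ → ℝ) (T : OSData (QCDField Nf) 4),
    IsQCDAlong (reg.scheme m z shift) T ∧ T.IsNontrivial QCDField.glue ∧ T.IsNonGaussian QCDField.glue ∧
    (∀ f g : Fin Nf, f ≠ g → T.IsNontrivial (QCDField.pseudoRe f g)) ∧
    ∃ Δ > 0, T.HasMassGap Δ ∧ (reg.scheme m z shift).HasLatticeMassGap Δ) →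
    ∃ C : ℝ, ∀ᶠ k in atTop, ∃ μ : ℝ, reg.mcrit k - reg.a k * C / reg.Zm k ≤ μ ∧
    ¬ (∀ (R R' : ℕ) (A : QCDLatticeObservable Nf R) (B : QCDLatticeObservable Nf R'), ∃ (C δ : ℝ) (S₀ : ℕ),
    0 < δ ∧ ∀ S : ℕ, S₀ ≤ S → ∀ n : ℕ, n ≤ S →
    ‖qcdLatticeConnectedCorr (reg.β k) (2 * S + 1) (fun _ : Fin Nf => μ) A B n‖ ≤ C * Real.exp (-(δ * n))) := by
  intro h₂ h₃ Nf hNf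
  rcases hNf with rfl | rfl
  · exact h₂
  · exact h₃

end Summit.QuantumFields.QCD.Theorems.HonestHeavyAnchorNonMassiveBelow
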